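import Summits.CriticalPhenomena.SAWScalingLimit.Theorems.SAWDevelopingMapHexConjectureRestrictionCocycleOfAspectBound
import Summits.CriticalPhenomena.SAWScalingLimit.Theorems.SAWDevelopingMapHexConjectureFloorRatioTransport
import Summits.CriticalPhenomena.SAWScalingLimit.Theorems.SAWDevelopingMapHexConjectureHalfPlanePackageGrowth
import HarnessLib

/-!
# Crux `HexConjecture` (stmt-CriticalPhenomena-0808), line `root-locality-replaces-loewner`:
the window inequality along the discretisation families from the floor-ratio limit and the arch aspect bound (FRL ∧ AAB ⟹ WIF)

Landing target:
`Summits/CriticalPhenomena/SAWScalingLimit/Theorems/SAWDevelopingMapHexConjectureWindowIneqFamiliesOfAspectBound.lean`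
(`--supports stmt-CriticalPhenomena-0808`; lead continuation prover-line-stmt-CriticalPhenomena-0808-c6-0).

`windowIneqFamilies_of_aspectBound`: for ONE admissible discretisation family `Λ δ` of a Dobrushin domain flat at both marks (single
family: no hull subdomain, no restriction map), the modulus floor-ratio limit FRL and the `η`-free arch aspect bound AAB give the WINDOW
INEQUALITY ALONG THE FAMILY at every radius `ρ₁' ≤ ρs` (the radius of the single-domain conformal package), for every `η > 0` (the
window bound `θb = θa` does not even depend on `η`; stated in the `η`-dependent shape of the named lever WIF):  eventually along `δ → 0⁺`, at the root cell,
`Σ_{d∈[θ₁ρ₁'/(2δ), θ₀ρ₁'/(2δ)]} Far^{ρ₁'/(2δ)}_{Λδ}(s_x→t_d) ≤ η Σ_{same} Z_{Λδ}(s_x→t_d)`.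
Proof: the single-domain package with growth (`exists_halfPlanePackageGrowth`: `Ψ = −1/φ⁻¹`, `L`, `Lb`, profile `G ≥ κt^{-5/4}` continuous on
`(0,ρs)`), the single-domain floor-ratio transport along arbitrary admissible floor families (`floorFamily_ratioTransport`, p125163) to
produce the profile hypothesis `hG`, and `windowIneq_of_aspectBound` (p125705) applied to the family nested in ITSELF (`Λ' := Λ`).
This is the second arrow of the lever hierarchy HPAT ⟹ WAL ⟹ WIF ⟸ FRL ∧ AAB of the line (WAL ⟹ WIF: p125991).
Sources: LawlerSchrammWerner2004SAW (§3.4, Prop. 2), DuminilCopinSmirnov2012 (Lemma 2).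
-/

noncomputable section

open scoped BigOperators Topology NNReal ENNReal Classical
open Filter Set MeasureTheory Metric
open Literature.Probability.LatticeModels (HexVertex hexGraph hexCenter Site)
open Literature.Probability.RandomPlanarGeometry
open Literature.Probability.RandomPlanarGeometry.SAW
open UpperHalfPlane (upperHalfPlaneSet)

namespace Summit.CriticalPhenomena.SAWScalingLimit.Theorems.HexConjecture.RootLocality

open Summit.CriticalPhenomena.SAWScalingLimit.Theorems.ObservableToSLE.FloorRatio

/-- The growth bound of the profile restricts to a smaller radius. [folklore] -/
theorem growth_mono_radius {G : ℝ → ℝ} {κ ρs ρ₁ : ℝ} (hρ₁s : ρ₁ ≤ ρs)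
    (hGκ : ∀ t : ℝ, 0 < t → t < ρs → κ * t ^ (-(5 / 4 : ℝ)) ≤ G t) :
    ∀ t : ℝ, 0 < t → t < ρ₁ → κ * t ^ (-(5 / 4 : ℝ)) ≤ G t :=
  fun t ht htρ₁ => hGκ t ht (lt_of_lt_of_le htρ₁ hρ₁s)

/-- **FRL ∧ AAB ⟹ WIF** (the window inequality along ONE admissible discretisation family).  See the module docstring.
[cite: LawlerSchrammWerner2004SAW, §3.4 ("SAW satisfies restriction") and Prop. 2] -/
theorem windowIneqFamilies_of_aspectBound
    (hFRM : (∀ (D D' : DobrushinDomain) (ρ : ℝ) (Λ : ℝ → Finset HexVertex) (m₀ m m' : ℝ → ℤ)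
      (a b b' : ℝ → Sym2 HexVertex) (Φ : ConformalEquiv D.carrier upperHalfPlaneSet)
      (L : ℂ → ℂ) (Lb Lb' : ℂ),
      D'.carrier = D.carrier → D'.pt 0 = D.pt 0 → 0 < ρ →
      D.carrier ∩ ball (D.pt 0) ρ = {z : ℂ | (D.pt 0).im < z.im} ∩ ball (D.pt 0) ρ →
      D.carrier ∩ ball (D.pt 1) ρ = {z : ℂ | (D.pt 1).im < z.im} ∩ ball (D.pt 1) ρ →
      D.carrier ∩ ball (D'.pt 1) ρ = {z : ℂ | (D'.pt 1).im < z.im} ∩ ball (D'.pt 1) ρ →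
      (∀ᶠ δ : ℝ in 𝓝[>] 0,
        hexDomainSimplyConnected (Λ δ) ∧ a δ ∈ hexDomainBoundary (Λ δ) ∧
        b δ ∈ hexDomainBoundary (Λ δ) ∧ b' δ ∈ hexDomainBoundary (Λ δ) ∧
        Nonempty (HexMidEdgeSAW (Λ δ) (a δ) (b δ)) ∧ Nonempty (HexMidEdgeSAW (Λ δ) (a δ) (b' δ)) ∧
        (hexGraph.induce (↑(Λ δ) : Set HexVertex)).Preconnected ∧
        (∀ v ∈ Λ δ, (δ : ℂ) * hexCenter v ∈ D.carrier) ∧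
        (∀ v : HexVertex, (δ : ℂ) * hexCenter v ∈ ball (D.pt 0) ρ → (v ∈ Λ δ ↔ m₀ δ ≤ v.1 1)) ∧
        (∀ v : HexVertex, (δ : ℂ) * hexCenter v ∈ ball (D.pt 1) ρ → (v ∈ Λ δ ↔ m δ ≤ v.1 1)) ∧
        (∀ v : HexVertex, (δ : ℂ) * hexCenter v ∈ ball (D'.pt 1) ρ → (v ∈ Λ δ ↔ m' δ ≤ v.1 1))) →
      (∀ K : Set ℂ, IsCompact K → K ⊆ D.carrier →
        ∀ᶠ δ : ℝ in 𝓝[>] 0, ∀ v : HexVertex, (δ : ℂ) * hexCenter v ∈ K → v ∈ Λ δ) →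
      Tendsto (fun δ : ℝ => (δ : ℂ) * hexMidpoint (a δ)) (𝓝[>] 0) (𝓝 (D.pt 0)) →
      Tendsto (fun δ : ℝ => (δ : ℂ) * hexMidpoint (b δ)) (𝓝[>] 0) (𝓝 (D.pt 1)) →
      Tendsto (fun δ : ℝ => (δ : ℂ) * hexMidpoint (b' δ)) (𝓝[>] 0) (𝓝 (D'.pt 1)) →
      Tendsto (fun x => ‖Φ x‖) (𝓝[D.carrier] (D.pt 0)) atTop →
      Φ.HasBoundaryValue (D.pt 1) 0 →
      ContinuousOn L D.carrier → (∀ z ∈ D.carrier, Complex.exp (L z) = deriv Φ z) →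
      Tendsto L (𝓝[D.carrier] (D.pt 1)) (𝓝 Lb) → Tendsto L (𝓝[D.carrier] (D'.pt 1)) (𝓝 Lb') →
      Tendsto (fun δ : ℝ =>
        ‖hexParafermionicObservable (Λ δ) (a δ) hexCriticalFugacity (5 / 8) (b' δ) /
          hexParafermionicObservable (Λ δ) (a δ) hexCriticalFugacity (5 / 8) (b δ)‖) (𝓝[>] 0)
        (𝓝 (Real.exp ((5 / 8) * (Lb' - Lb).re)))))
    (hAAB : ∃ θa θb C : ℝ, 0 < θa ∧ θa < θb ∧ θb ≤ 1 / 4 ∧ 0 < C ∧ ∀ θ₁ : ℝ, 0 < θ₁ → θ₁ < θa →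
      ∃ R₀ : ℝ, 0 < R₀ ∧ ∀ R : ℝ, R₀ ≤ R →
      ∀ (x : Site 2) (L B : Finset HexVertex) (S S' : Finset ℤ),
        (∀ v ∈ L, x 1 ≤ v.1 1) →
        (∀ v : HexVertex, v ∈ B ↔ (x 1 ≤ v.1 1 ∧
          dist (hexCenter v) (hexMidpoint s((x - Pi.single 1 1, 1), (x, 0))) ≤ R)) →
        (∀ d : ℤ, d ∈ S ↔ (θ₁ * R ≤ (d : ℝ) ∧ (d : ℝ) ≤ θa * R)) →
        (∀ d : ℤ, d ∈ S' ↔ (θa * R ≤ (d : ℝ) ∧ (d : ℝ) ≤ θb * R)) →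
        ∑ d ∈ S, (∑ γ : HexMidEdgeSAW L s((x - Pi.single 1 1, 1), (x, 0))
            s((x + Pi.single 0 d - Pi.single 1 1, 1), (x + Pi.single 0 d, 0)),
          if ∃ v ∈ γ.verts, R ≤ dist (hexCenter v) (hexMidpoint s((x - Pi.single 1 1, 1), (x, 0)))
          then hexCriticalFugacity ^ γ.length else 0) ≤
        C * ∑ d ∈ S', ∑ γ : HexMidEdgeSAW B s((x - Pi.single 1 1, 1), (x, 0))
            s((x + Pi.single 0 d - Pi.single 1 1, 1), (x + Pi.single 0 d, 0)), hexCriticalFugacity ^ γ.length)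
    (D : DobrushinDomain) (ρ : ℝ) (Λ : ℝ → Finset HexVertex) (m : ℝ → ℤ) (a b : ℝ → Sym2 HexVertex)
    (φ : ConformalEquiv upperHalfPlaneSet D.carrier) (hρ : 0 < ρ)
    (hflat0 : D.carrier ∩ ball (D.pt 0) ρ = {z : ℂ | (D.pt 0).im < z.im} ∩ ball (D.pt 0) ρ)
    (hflat1 : D.carrier ∩ ball (D.pt 1) ρ = {z : ℂ | (D.pt 1).im < z.im} ∩ ball (D.pt 1) ρ)
    (hφ : D.IsChordalUniformizing φ)
    (hev : ∀ᶠ δ : ℝ in 𝓝[>] 0,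
      hexDomainSimplyConnected (Λ δ) ∧ (hexGraph.induce (↑(Λ δ) : Set HexVertex)).Preconnected ∧
      a δ ∈ hexDomainBoundary (Λ δ) ∧ b δ ∈ hexDomainBoundary (Λ δ) ∧
      Nonempty (HexMidEdgeSAW (Λ δ) (a δ) (b δ)) ∧
      (∀ v ∈ Λ δ, (δ : ℂ) * hexCenter v ∈ D.carrier ∧ m δ ≤ v.1 1) ∧
      (∀ v : HexVertex, (δ : ℂ) * hexCenter v ∈ ball (D.pt 0) ρ ∪ ball (D.pt 1) ρ →
        (v ∈ Λ δ ↔ m δ ≤ v.1 1)))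
    (hKΛ : ∀ K : Set ℂ, IsCompact K → K ⊆ D.carrier →
      ∀ᶠ δ : ℝ in 𝓝[>] 0, ∀ v : HexVertex, (δ : ℂ) * hexCenter v ∈ K → v ∈ Λ δ)
    (ha : Tendsto (fun δ : ℝ => (δ : ℂ) * hexMidpoint (a δ)) (𝓝[>] 0) (𝓝 (D.pt 0)))
    (hb : Tendsto (fun δ : ℝ => (δ : ℂ) * hexMidpoint (b δ)) (𝓝[>] 0) (𝓝 (D.pt 1))) :
    ∃ ρs : ℝ, 0 < ρs ∧ ρs ≤ ρ ∧ ∀ ρ₁ : ℝ, 0 < ρ₁ → ρ₁ ≤ ρs → ∀ η : ℝ, 0 < η → ∃ θb : ℝ, 0 < θb ∧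
      ∀ θ₀ : ℝ, 0 < θ₀ → θ₀ ≤ θb → ∃ θ₁ : ℝ, 0 < θ₁ ∧ θ₁ < θ₀ ∧
      ∀ᶠ δ : ℝ in 𝓝[>] 0, ∀ x : Site 2, x 1 = m δ → a δ = s((x - Pi.single 1 1, 1), (x, 0)) →
        ∑ d ∈ Finset.Icc ⌈θ₁ * (ρ₁ / 2 / δ)⌉ ⌊θ₀ * (ρ₁ / 2 / δ)⌋,
            (∑ γ : HexMidEdgeSAW (Λ δ) s((x - Pi.single 1 1, 1), (x, 0))
              s((x + Pi.single 0 d - Pi.single 1 1, 1), (x + Pi.single 0 d, 0)),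
            if ∃ v ∈ γ.verts, ρ₁ / 2 / δ ≤ dist (hexCenter v) (hexMidpoint s((x - Pi.single 1 1, 1), (x, 0)))
            then hexCriticalFugacity ^ γ.length else 0) ≤
          η * ∑ d ∈ Finset.Icc ⌈θ₁ * (ρ₁ / 2 / δ)⌉ ⌊θ₀ * (ρ₁ / 2 / δ)⌋,
            ∑ γ : HexMidEdgeSAW (Λ δ) s((x - Pi.single 1 1, 1), (x, 0))
              s((x + Pi.single 0 d - Pi.single 1 1, 1), (x + Pi.single 0 d, 0)), hexCriticalFugacity ^ γ.length := by
  -- the single-domain conformal package with growth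
  obtain ⟨Ψ, L, Lb, ρs, G, κ, hρs, hρsρ, _, hΨinf, hΨb, hLc, hLe, hLb, hfloor, hκ, hGc, hGκ⟩ :=
    exists_halfPlanePackageGrowth D ρ φ hρ hflat0 hflat1 hφ
  obtain ⟨θa, θb, C, hθa, hθab, hθb4, hC, hA⟩ := hAAB
  refine ⟨ρs, hρs, hρsρ, fun ρ₁ hρ₁ hρ₁s η hη => ⟨θa, hθa, ?_⟩⟩
  have hρ₁ρ : ρ₁ ≤ ρ := hρ₁s.trans hρsρ
  -- the family nested in itself satisfies the two-family admissibility clause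
  have hev₂ : ∀ᶠ δ : ℝ in 𝓝[>] 0,
      Λ δ ⊆ Λ δ ∧ hexDomainSimplyConnected (Λ δ) ∧ hexDomainSimplyConnected (Λ δ) ∧
      (hexGraph.induce (↑(Λ δ) : Set HexVertex)).Preconnected ∧
      (hexGraph.induce (↑(Λ δ) : Set HexVertex)).Preconnected ∧
      a δ ∈ hexDomainBoundary (Λ δ) ∧ b δ ∈ hexDomainBoundary (Λ δ) ∧
      a δ ∈ hexDomainBoundary (Λ δ) ∧ b δ ∈ hexDomainBoundary (Λ δ) ∧
      Nonempty (HexMidEdgeSAW (Λ δ) (a δ) (b δ)) ∧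
      (∀ v ∈ Λ δ, (δ : ℂ) * hexCenter v ∈ D.carrier ∧ m δ ≤ v.1 1) ∧
      (∀ v ∈ Λ δ, (δ : ℂ) * hexCenter v ∈ D.carrier) ∧
      (∀ v : HexVertex, (δ : ℂ) * hexCenter v ∈ ball (D.pt 0) ρ ∪ ball (D.pt 1) ρ →
        ((v ∈ Λ δ ↔ m δ ≤ v.1 1) ∧ (v ∈ Λ δ ↔ m δ ≤ v.1 1))) := by
    filter_upwards [hev] with δ h
    obtain ⟨hsc, hconn, haΛ, hbΛ, hne, hΛD, hrows⟩ := h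
    exact ⟨subset_rfl, hsc, hsc, hconn, hconn, haΛ, hbΛ, haΛ, hbΛ, hne, hΛD, fun v hv => (hΛD v hv).1,
      fun v hv => ⟨hrows v hv, hrows v hv⟩⟩
  -- the single-family admissibility clause with the floor forms of `a δ`, `b δ`
  have hdaux : dist (D.pt 0 + ((ρ₁ / 16 : ℝ) : ℂ)) (D.pt 0) = ρ₁ / 16 := dist_pt_add_real _ (by positivity)
  obtain ⟨_, _, -, hevAB⟩ := floorData D D ρ Λ Λ m a b hρ hev₂ ha hb (s := D.pt 0 + ((ρ₁ / 16 : ℝ) : ℂ))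
    (pt_add_ne (by positivity)) (by simp) (by rw [hdaux]; linarith) one_pos (by rw [hdaux]; linarith)
  have hev₁ : ∀ᶠ δ : ℝ in 𝓝[>] 0,
      hexDomainSimplyConnected (Λ δ) ∧ (hexGraph.induce (↑(Λ δ) : Set HexVertex)).Preconnected ∧
      a δ ∈ hexDomainBoundary (Λ δ) ∧ b δ ∈ hexDomainBoundary (Λ δ) ∧
      Nonempty (HexMidEdgeSAW (Λ δ) (a δ) (b δ)) ∧
      (∀ v ∈ Λ δ, (δ : ℂ) * hexCenter v ∈ D.carrier ∧ m δ ≤ v.1 1) ∧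
      (∀ v : HexVertex, (δ : ℂ) * hexCenter v ∈ ball (D.pt 0) ρ ∪ ball (D.pt 1) ρ →
        (v ∈ Λ δ ↔ m δ ≤ v.1 1)) ∧
      ∃ x x' : Site 2, a δ = s((x - Pi.single 1 1, 1), (x, 0)) ∧
        b δ = s((x' - Pi.single 1 1, 1), (x', 0)) ∧ x' 1 = x 1 ∧ x' ≠ x := by
    filter_upwards [hev, hevAB] with δ h hAB
    obtain ⟨hsc, hconn, haΛ, hbΛ, hne, hΛD, hrows⟩ := h
    obtain ⟨x, x', _, hx1, hx'1, -, hx'x, -, hax, hbx, -, -, -, -, -, -, -, -⟩ := hAB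
    exact ⟨hsc, hconn, haΛ, hbΛ, hne, hΛD, hrows, x, x', hax, hbx, hx'1.trans hx1.symm, hx'x⟩
  -- the single-domain floor-ratio transport with value `G t` (radius `ρ₁ ≤ ρs`)
  have hG : ∀ (e : ℝ → Sym2 HexVertex) (t : ℝ), 0 < t → t ≤ ρ₁ / 4 →
      Tendsto (fun δ : ℝ => (δ : ℂ) * hexMidpoint (e δ)) (𝓝[>] 0) (𝓝 (D.pt 0 + t)) →
      (∀ᶠ δ : ℝ in 𝓝[>] 0, e δ ∈ hexDomainBoundary (Λ δ) ∧ Nonempty (HexMidEdgeSAW (Λ δ) (a δ) (e δ)) ∧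
        ∃ x yy : Site 2, a δ = s((x - Pi.single 1 1, 1), (x, 0)) ∧
          e δ = s((yy - Pi.single 1 1, 1), (yy, 0)) ∧ yy 1 = x 1 ∧ yy ≠ x) →
      Tendsto (fun δ : ℝ =>
        (∑ γ : HexMidEdgeSAW (Λ δ) (a δ) (e δ), hexCriticalFugacity ^ γ.length) /
          (∑ γ : HexMidEdgeSAW (Λ δ) (a δ) (b δ), hexCriticalFugacity ^ γ.length)) (𝓝[>] 0) (𝓝 (G t)) := by
    intro e t ht0 htρ he heE
    obtain ⟨hsfr, -, Ls, hLs, hGt⟩ := hfloor t ht0 (by linarith)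
    rw [← hGt]
    exact floorFamily_ratioTransport hFRM D ρ Λ m a b hρ hev₁ hKΛ ha hb hρ₁ hρ₁ρ hflat0 hflat1 Ψ L Lb
      hΨinf hΨb hLc hLe hLb ht0 htρ hsfr hLs e he heE
  -- the window inequality (two-family theorem with `Λ' := Λ`, `D' := D`)
  exact windowIneq_of_aspectBound D D ρ Λ Λ m a b hρ hev₂ ha hb hρ₁ hρ₁ρ hκ (hGc.mono (Ioo_subset_Ioo_right hρ₁s))
    (growth_mono_radius hρ₁s hGκ) hG hθa hθab hθb4 hC hA η hη

/-! ### Registered form -/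

/-- **Registered sub-goal `stub_growthMonoRadius`** (crux item stmt-CriticalPhenomena-0808, line `root-locality-replaces-loewner`,
lead continuation c6): the growth bound restricts to smaller radii (`growth_mono_radius`). [folklore] -/
theorem stub_growthMonoRadius : ∀ (G : ℝ → ℝ) (κ ρs ρ₁ : ℝ), ρ₁ ≤ ρs → (∀ t : ℝ, 0 < t → t < ρs → κ * t ^ (-(5 / 4 : ℝ)) ≤ G t) → ∀ t : ℝ, 0 < t → t < ρ₁ → κ * t ^ (-(5 / 4 : ℝ)) ≤ G t :=
  fun _ _ _ _ h hG => growth_mono_radius h hG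

end Summit.CriticalPhenomena.SAWScalingLimit.Theorems.HexConjecture.RootLocality

end
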